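import Literature.Claims.NS.ClayVariants
import Literature.Analysis.FluidPDE.TorusClassicalH1Balance
import HarnessLib

/-!
# Claim skeleton: Kaliyeva–Kaliyev (WCE 2014), «Existence and Uniqueness of the Navier–Stokes
# Problem in Infinite Space» — rotor reformulation, a matrix Volterra–Fredholm integral equation,
# successive approximations

Cell `ns-claims` (D-0090 NS-CLAIMS SWEEP), claim C180 (B17 promoted, RULINGS v1.56 lead-1 g7
2026-08-27T20:41:20Z), typist `ns-claims-typist-1` (g7). UNREFEREED CLAIM under adjudication —
NOTHING in this file asserts a step: every `Step_k` is a `Prop`; the only `theorem`s are the kernel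
COMPOSITION of the paper's own implications and bookkeeping.

Text of record: K. Kaliyeva, A. Kaliyev, «Existence and Uniqueness of the Navier-Stokes Problem in
Infinite Space», *Proceedings of the World Congress on Engineering 2014, Vol II* (WCE 2014, London,
2–4 July 2014; ISBN 978-988-19253-5-0), pp. 1288–1293 [Kaliyeva2014]; file
`pub/ns-claims/sources/Kaliyeva2014/WCE2014_pp1288-1293.pdf` sha16 3066e5d4c8fbf4e6 (6 pp., PDF page
N = printed p.1287+N), `LOCATORS.md` by ns-claims-lit-3 g11. The pdf text layer garbles every Word-set
display and DROPS the «≠» glyph (ns-claims-lit-2 g8 2026-08-27T20:44:58Z): displays below are read from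
the page RENDERS (`sources/Kaliyeva2014/renders-lit2/p00N.png`, lit-3 g11 `renders/`), prose from
`pages/p00N.txt`. Locators: «(N) p.M» = display (N) on printed page M.

## Claimed statement (as printed)

p.1292 (§V), after «Recall the notations Ω = R³ and Ω_T = R³ × (0 < t < ∞) we look for periodic
solution for the problem (1)-(3). We assume that functions f_i(x,t) and u_{0i}(x,t) satisfy
u_{0i}(x) = u_{0i}(x + k_j), f_i(x,t) = f_i(x + k_j,t) for 1 ≤ j ≤ 3, where k_j = j-th is unit vector
in R³»:

**Theorem 2.** «Let u_{0i}(x,t) ∈ H^{(2)}(Ω) and f_i(x,t) ∈ L₂(Ω_T^{(i)}) be periodic functions and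
rot f⃗ ≠ 0. Under this assumption there exists a unique unstable periodic solution of the
Navier-Stokes problem (1) - (3)» [continued p.1293: the representation «u⃗ = ∫₀ᵗdτ∫_Ω R[A(F⃗(ξ,τ))
Γ(x−ξ,t−τ)]dΩ + F⃗(x,t), F⃗ = b⃗ ∗ G + u⃗₀ ∗ G», the pressure relation (23) and the bounds
«‖u⃗‖_{H^{(2,1)}(Ω_T)} ≤ C₀(‖u⃗₀‖_{H^{(1)}} + ‖Ψ⃗‖_{H^{(3,0)}})[1 + C₁(…)e^{C₂t(…)²}]», same for
`‖p‖_{H^{(1,0)}}`]. Problem (1)–(3), p.1288: (1) `∂u⃗/∂t + (u⃗∇)u⃗ = νΔu⃗ − (1/ρ)∇p + f⃗(x,t)` in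
`Ω_T`, (2) `div u⃗ = 0` in `Ω_T`, (3) `u⃗|_{t=0} = u⃗₀(x)` on `Ω` («unstable» = non-stationary,
the paper's antonym of the «stable»/potential case of Theorem 1 — recorded, not a condition).
RECORDED second face, **Theorem 1** p.1292: the same with «rot f⃗ = 0, rot u⃗₀ = 0» and the explicit
heat-potential formula (14) p.1289 — the irrotational case (`Theorem1Face`, TRUE-type: on 𝕋³ a
periodic curl-free divergence-free field is constant).

## Typing decisions

* CARRIER. Unit periods `k_j` in each coordinate ⇒ the unit flat torus `UnitAddTorus (Fin 3)` and the
  tree's torus calculus / classical Navier–Stokes vocabulary (`Literature.Analysis.FunctionSpaces.Torus.*`: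
  `IsClassicalNSSolutionOn`, `timeDerivWithin`, `convect`, `gradient`, `divergence`, `laplacian`,
  `partialDeriv`). The constant density is absorbed (`p` below stands for `p/ρ`); `ν > 0` is the
  paper's kinematic viscosity. Horizon `Ω_T = ℝ³ × (0 < t < ∞)` with the initial condition (3): the
  time set `Ici 0` (classical up to `t = 0`), EXACTLY the printed infinite horizon (RULINGS v1.56 (ii):
  no finite `T` is fixed on p.1292 — lit-2 g8 / lit-3 g11 render check).
* CLASSES (Δ recorded, HYGIENE «cite never restate»). Printed: data `H^{(2)}(Ω)`, force `L₂(Ω_T)`,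
  solution = the paper's «weak»/integral-equation solution (abstract; (22) p.1292 gives an `L₂` bound,
  p.1293 `H^{(2,1)}` bounds). TYPED: smooth periodic divergence-free data, forces smooth on
  `[0,∞) × 𝕋³`, CLASSICAL solutions — a SUB-class on every hypothesis side, so `ClaimedTheorem` below is
  WEAKER than the printed sentence (a refutation of a Step over the smooth class refutes the printed,
  wider one a fortiori; `-- TODO(general form): H² data, L² forces, the paper's weak class`).
  «rot f⃗ ≠ 0» is rendered orientation-free: some antisymmetric velocity-gradient entry
  `∂ᵢfⱼ − ∂ⱼfᵢ` of some slice is non-zero somewhere (`RotNonzero`).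
* THE BRACKET `[u⃗ × rot u⃗]`. The paper introduces it through its identity (4) p.1289
  «½ grad u⃗² = [u⃗ × rot u⃗] + (u⃗∇)u⃗»; this file DEFINES `lamb u := grad(½|u|²) − (u·∇)u`
  accordingly (the classical Lamb-vector identity; no orientation or cross product needed), so every
  display containing `[u⃗ × rot u⃗]` is typed token for token.
* GRAIN. The §IV chain is typed at the level of its OUTPUT displays: (5) Lamb form (`Step_5`, TRUE —
  proved below), (6) the force potential (`Step_6`, support of the pressure formulas (9)/(23) only),
  (17)–(19) «div g⃗ = 0» for `g⃗ = ∂ₜu⃗ − [u⃗ × rot u⃗] − νΔu⃗` (`Step_19`, the third line of system (19)),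
  (20) «∂u⃗/∂t − νΔu⃗ − [u⃗ × rot u⃗] = b⃗(x,t)» with `b⃗` the explicit functional of `f⃗` ALONE printed on
  p.1291 (`Step_20`, typed CHARITABLY as «some b depending only on f» — any `b` is allowed), (21)–(22)
  «Due to this fact we have the unique solution of the problem» for the nonlinear equation (20) with
  datum (13) (`Step_22`, solution grain), and p.1292 «Following the classical procedure we get the
  uniqueness and stability of solution for the problem (1)-(3). Also we obtain equation for the
  pressure function (23)» (`Step_23`: back from (20) to (1)–(3)). Display (21) p.1291 (the factorial
  majorant `‖u^{(n)}‖² ≤ M₀(‖u₀‖²+t‖f‖²)/1! + M₀²√t(‖u₀‖²+t‖f‖²)²/2! + M₀³t^{3/2}(‖u₀‖²+t‖f‖²)⁴/3! + … +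
  M₀ⁿ t^{n+1/2}(‖u₀‖²+t‖f‖²)^{2n}/n!` AS PRINTED — bracket exponents 1, 2, 4, …, 2n and t-exponents
  0, 1/2, 3/2, …, n+1/2 as they stand, lit-2 g8 20:45:23Z) is RECORDED here as the printed support of
  `Step_22`; its scalar (F15) face is NOT typed in rev 1 (the displayed terms follow no single one-step
  rule: the rule read off lines 1–2, `y_{n+1} ≤ M₀X + (√t/2)yₙ²`, gives an `X³` term and a different
  `X⁴` coefficient at line 3) — an additive rev types it if the refuter or the chair asks.
* NOT TYPED (recorded): `f⃗*` (p.1290, «a convolution between vector and matrix» of second derivatives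
  of `f` with the Newtonian kernel — printed with row-inconsistent signs), (16) «rot[…] = rot f⃗*» (which
  with (15)'s right-hand side `f⃗* + 2f⃗` silently needs `rot f⃗ = 0`), the Fourier inversion of (19), the
  kernels `G, Γ`, `A(F)` p.1292, `Ψ⃗` and the `H^{(2,1)}`/`H^{(1,0)}` bounds of p.1292–1293 (no Step of
  the existence chain consumes them; the bounds are conclusions printed after (22)).

## Clay delta (reference `ClayVariants.lean`; lit-4 g9 CLAY DOORS 2026-08-27T20:42:23Z)

Nearest: (B) `ClayVariants.clayPeriodic.Regularity` — ADJACENT only. Δ1 domain 𝕋³-periodic on ℝ³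
(=) · Δ2 NS, `ν > 0` (=) · **Δ6 force: Theorem 2 REQUIRES `rot f⃗ ≠ 0`, which EXCLUDES Clay's
`f ≡ 0`; Theorem 1 covers `rot f⃗ = 0` only together with `rot u⃗₀ = 0` — neither printed theorem
covers (B)'s case (f ≡ 0, rotational data)** · Δ4 data `H^{(2)}` printed (WIDER than smooth (8)),
typed smooth · Δ5 solution notion: the paper's weak / integral-equation class with `L₂` / `H^{(2,1)}`
bounds (NOT `C^∞` + (10)–(11)); typed classical · Δ3 horizon `(0, ∞)` (=) · pressure: «potential
field», (23); periodicity of `p` not stated (CMI erratum axis open). Consequently NO `clay_of_claimed`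
is derivable token for token (recorded, not a «wrong problem» locator by itself: the statement is an
honest (B)-adjacent forced periodic existence-and-uniqueness claim); no `ClayDelta` hypothesis is
manufactured (lit-4 PITFALL (a)).

## Steps (ordered index)

* `Step_5` — (4)–(5) p.1289: Lamb form of (1). TRUE (`step_5_holds`, from the definition of `lamb`).
* `Step_6` — (6) p.1289 «grad Φ = −f⃗»: a periodic potential of the force exists. Support of (8), (9),
  (15), (23) only; typist's flag: false whenever `rot f⃗ ≠ 0` (Theorem 2's own hypothesis) or
  `∫f ≠ 0`. NOT consumed by the composition.
* `Step_19` — (17)–(19) p.1290: «div g⃗ = 0», `g⃗ = ∂ₜu⃗ − [u⃗ × rot u⃗] − νΔu⃗`, along every solution.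
  Typist's flag: SUSPICIOUS (`div g⃗ = −div[u⃗ × rot u⃗]`, not zero in general); it is what makes `b⃗`
  in (20) independent of `u⃗`. Not consumed (its output (20) is).
* `Step_20` — (20) p.1291: every solution of (1)–(3) with force `f⃗` satisfies
  `∂ₜu⃗ − νΔu⃗ − [u⃗ × rot u⃗] = b⃗` for ONE field `b⃗ = b⃗[f⃗]`. LOAD-BEARING; typist's flag: SUSPICIOUS
  (the gradient `grad(u²/2 + p/ρ − Φ)` of (15) has no counterpart in (20)).
* `Step_22` — (21)–(22) p.1291: the nonlinear problem (20) + (13) has exactly one solution on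
  `[0, ∞)` for every datum and every `b⃗` (solution grain; the printed support is the majorant (21)).
  Typist's flag: open-strength as typed (global smooth solvability of a 3-D quadratic parabolic system).
* `Step_23` — p.1292 l.h. column ((22)–(23) and «Following the classical procedure …»): a solution of
  (20) + (13) from a divergence-free datum, with the pressure of (23), solves (1)–(3). Typist's flag:
  suspicious (nothing printed keeps `div u⃗ = 0` along (20)).

## COMPOSITION — proved

`claim_of_steps : Step_5 → Step_6 → Step_19 → Step_20 → Step_22 → Step_23 → ClaimedTheorem`
(hypotheses in print order; CONSUMED: 20, 22, 23 — existence: `b⃗[f⃗]` from 20, the solution of (20)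
from 22, the pressure from 23; uniqueness: two solutions of (1)–(3) solve (20) with the same `b⃗` by
20, hence coincide by 22's uniqueness clause). The paper's logic composes; the weight sits on
`Step_20` (with `Step_19` as its printed mechanism) and `Step_22`.

WHAT THIS IS NOT: not a claim about NS regularity or blow-up; not a claim about any author beyond the
typed locator.
-/

open MeasureTheory Set Filter
open scoped ContDiff RealInnerProductSpace Topology

namespace Literature.Claims.NS.Kaliyeva2014

open Literature.Analysis Literature.Analysis.FunctionSpaces

noncomputable section

/-! ## Vocabulary (definitions with bodies; nothing asserted) -/

/-- The period cell: unit periods `k_j = j-th unit vector` in each coordinate (p.1292) — the unit flat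
torus `𝕋³ = ℝ³/ℤ³`. (Kaliyeva2014: p.1292 «u_{0i}(x) = u_{0i}(x + k_j), f_i(x,t) = f_i(x + k_j,t)») [claim: Kaliyeva2014, status: disputed] -/
abbrev T3 : Type := UnitAddTorus (Fin 3)

/-- Velocity values `u⃗ = u₁i + u₂j + u₃k ∈ ℝ³` (p.1288). (Kaliyeva2014: §II p.1288) [claim: Kaliyeva2014, status: disputed] -/
abbrev E3 : Type := EuclideanSpace ℝ (Fin 3)

/-- The bracket `[u⃗ × rot u⃗]`, introduced by the paper through its identity (4) p.1289
«½ grad u⃗² = [u⃗ × rot u⃗] + (u⃗∇)u⃗» and typed accordingly: `[u × rot u] := grad(½|u|²) − (u·∇)u`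
(the Lamb-vector identity, orientation-free). (Kaliyeva2014: (4) p.1289) [claim: Kaliyeva2014, status: disputed] -/
def lamb (u : T3 → E3) (x : T3) : E3 :=
  Torus.gradient (fun y => ‖u y‖ ^ 2 / 2) x - Torus.convect u u x

/-- The antisymmetric velocity-gradient entry `(rot-tensor)ᵢⱼ = ∂ᵢvⱼ − ∂ⱼvᵢ` of a field on `𝕋³`
(the components of `rot v⃗`, p.1289 determinant display, up to orientation). (Kaliyeva2014: p.1289 «rot u⃗ = ∇ × u⃗») [claim: Kaliyeva2014, status: disputed] -/
def rotEntry (v : T3 → E3) (i j : Fin 3) (x : T3) : ℝ :=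
  (Torus.partialDeriv i v x) j - (Torus.partialDeriv j v x) i

/-- «rot f⃗ ≠ 0» (Theorem 2, p.1292; §II p.1289 «In the second step we assume that rot f⃗ ≠ 0»): the
force is NOT curl-free — some entry `∂ᵢfⱼ − ∂ⱼfᵢ` of some slice `t ≥ 0` is non-zero at some point.
(Kaliyeva2014: Thm 2 p.1292) [claim: Kaliyeva2014, status: disputed] -/
def RotNonzero (f : ℝ → T3 → E3) : Prop :=
  ∃ t : ℝ, 0 ≤ t ∧ ∃ (x : T3) (i j : Fin 3), rotEntry (f t) i j x ≠ 0

/-- «rot v⃗ = 0» for a single field (Theorem 1's hypotheses `rot f⃗ = 0, rot u⃗₀ = 0`, p.1292).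
(Kaliyeva2014: Thm 1 p.1292) [claim: Kaliyeva2014, status: disputed] -/
def RotZero (v : T3 → E3) : Prop :=
  ∀ (x : T3) (i j : Fin 3), rotEntry v i j x = 0

/-- The data class, TYPED: smooth, divergence-free, `ℤ³`-periodic (a sub-class of the printed
«u_{0i} ∈ H^{(2)}(Ω) periodic»; `div u⃗₀ = 0` is forced by (2) at `t = 0` for classical solutions).
-- TODO(general form): `H^{(2)}` data.
(Kaliyeva2014: Thm 2 p.1292 with (2)–(3) p.1288) [claim: Kaliyeva2014, status: disputed] -/
def IsDatum (u₀ : T3 → E3) : Prop :=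
  Torus.IsSmooth u₀ ∧ Torus.IsDivFree u₀

/-- The force class, TYPED: jointly smooth on `[0,∞) × 𝕋³` (a sub-class of the printed
«f_i ∈ L₂(Ω_T) periodic»). -- TODO(general form): `L₂(Ω_T)` forces.
(Kaliyeva2014: Thm 2 p.1292 with (1) p.1288) [claim: Kaliyeva2014, status: disputed] -/
def IsForce (f : ℝ → T3 → E3) : Prop :=
  Torus.IsSmoothSpaceTimeOn (Ici 0) f

/-- «periodic solution of the Navier–Stokes problem (1)–(3)» on `Ω_T = ℝ³ × (0 < t < ∞)` from the datum
`u⃗₀` (p.1288 (1)–(3), p.1292), TYPED classical: `∂ₜu + (u·∇)u = νΔu − ∇p + f`, `div u = 0` on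
`[0,∞) × 𝕋³` (`p` standing for `p/ρ`) and `u(0) = u₀`. -- TODO(general form): the paper's weak class.
(Kaliyeva2014: (1)–(3) p.1288; Thm 2 p.1292) [claim: Kaliyeva2014, status: disputed] -/
def IsSolution (ν : ℝ) (f : ℝ → T3 → E3) (u₀ : T3 → E3) (u : ℝ → T3 → E3) (p : ℝ → T3 → ℝ) : Prop :=
  Torus.IsClassicalNSSolutionOn (Ici 0) ν f u p ∧ u 0 = u₀

/-! ## The claimed statement -/

/-- **CLAIMED — Theorem 2, p.1292 (AS PRINTED, over the typed sub-classes):** «Let u_{0i} ∈ H^{(2)}(Ω)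
and f_i ∈ L₂(Ω_T) be periodic functions and rot f⃗ ≠ 0. Under this assumption there exists a unique
unstable periodic solution of the Navier-Stokes problem (1) - (3)», `Ω_T = ℝ³ × (0 < t < ∞)`: for every
viscosity `ν > 0`, every datum and every force with `rot f⃗ ≠ 0`, a solution of (1)–(3) on `[0, ∞)`
EXISTS and any two solutions have the same velocity. (Kaliyeva2014: Thm 2 p.1292) [claim: Kaliyeva2014, status: disputed] -/
def ClaimedTheorem : Prop :=
  ∀ ν : ℝ, 0 < ν → ∀ u₀ : T3 → E3, IsDatum u₀ → ∀ f : ℝ → T3 → E3, IsForce f → RotNonzero f →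
    (∃ (u : ℝ → T3 → E3) (p : ℝ → T3 → ℝ), IsSolution ν f u₀ u p) ∧
      ∀ (u u' : ℝ → T3 → E3) (p p' : ℝ → T3 → ℝ),
        IsSolution ν f u₀ u p → IsSolution ν f u₀ u' p' → ∀ t : ℝ, 0 ≤ t → u t = u' t

/-- **RECORDED second face — Theorem 1, p.1292 (the potential / «stable» case):** «Let u_{0i} ∈ H^{(2)}(Ω)
and f_i ∈ L₂(Ω_T) be periodic functions and rot f⃗ = 0, rot u⃗₀ = 0. Then there exists a unique stable
periodic solution u⃗ = ∫u⃗₀(ξ)G(x−ξ,t)dξ + 2∫₀ᵗdτ∫f⃗(ξ,τ)G(x−ξ,t−τ)dξ for the Navier-Stokes problem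
(1)–(3) and a unique scalar function of pressure p(x,t) which satisfies (9)» — existence and velocity
uniqueness in the curl-free case (the explicit formula and (9) are not typed). TRUE-type (on `𝕋³` a
smooth periodic curl-free divergence-free field is constant); NOT part of the composition.
(Kaliyeva2014: Thm 1 p.1292, (14) p.1289) [claim: Kaliyeva2014, status: disputed] -/
def Theorem1Face : Prop :=
  ∀ ν : ℝ, 0 < ν → ∀ u₀ : T3 → E3, IsDatum u₀ → RotZero u₀ → ∀ f : ℝ → T3 → E3, IsForce f →
    (∀ t : ℝ, 0 ≤ t → RotZero (f t)) →
    (∃ (u : ℝ → T3 → E3) (p : ℝ → T3 → ℝ), IsSolution ν f u₀ u p) ∧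
      ∀ (u u' : ℝ → T3 → E3) (p p' : ℝ → T3 → ℝ),
        IsSolution ν f u₀ u p → IsSolution ν f u₀ u' p' → ∀ t : ℝ, 0 ≤ t → u t = u' t

/-! ## Steps (Props; none asserted) -/

/-- **Step (5) — the Lamb form of (1), p.1289 (4)–(5):** «we have got
∂u⃗/∂t + grad(p/ρ + ½u⃗²) = [u⃗ × rot u⃗] + νΔu⃗ + f⃗(x,t)» along every solution of (1)–(3). Typist's flag:
TRUE (vector identity (4); with this file's `lamb` it is (1) rewritten — `step_5_holds`).
(Kaliyeva2014: (4)–(5) p.1289) [claim: Kaliyeva2014, status: disputed] -/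
def Step_5 : Prop :=
  ∀ (ν : ℝ) (f u : ℝ → T3 → E3) (p : ℝ → T3 → ℝ),
    Torus.IsClassicalNSSolutionOn (Ici 0) ν f u p → ∀ t : ℝ, 0 ≤ t → ∀ x : T3,
      Torus.timeDerivWithin (Ici 0) u t x +
          (Torus.gradient (p t) x + Torus.gradient (fun y => ‖u t y‖ ^ 2 / 2) x) =
        lamb (u t) x + ν • Torus.laplacian (u t) x + f t x

/-- **Step (6) — the force potential, p.1289:** «Considering the function which represents potential
energy grad Φ(x,t) = −f⃗(x,t) (6)» — for the force of (1), a periodic scalar potential exists at every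
time. Support of (8), (9), (15) and the pressure formula (23) only; typist's flag: false for every force
with `rot f⃗ ≠ 0` (Theorem 2's hypothesis) or non-zero mean; NOT consumed by the composition.
(Kaliyeva2014: (6) p.1289) [claim: Kaliyeva2014, status: disputed] -/
def Step_6 : Prop :=
  ∀ f : ℝ → T3 → E3, IsForce f → ∀ t : ℝ, 0 ≤ t →
    ∃ Φ : T3 → ℝ, Torus.IsSmooth Φ ∧ ∀ x : T3, Torus.gradient Φ x = -f t x

/-- The paper's `g⃗` of (17) p.1290: `g⃗ = ∂u⃗/∂t − [u⃗ × rot u⃗] − νΔu⃗` along a space-time field.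
(Kaliyeva2014: (17) p.1290) [claim: Kaliyeva2014, status: disputed] -/
def gField (ν : ℝ) (u : ℝ → T3 → E3) (t : ℝ) (x : T3) : E3 :=
  Torus.timeDerivWithin (Ici 0) u t x - lamb (u t) x - ν • Torus.laplacian (u t) x

/-- **Step (19) — the third line of system (19), p.1290:** after (16) «rot[∂u⃗/∂t − [u⃗ × rot u⃗] − νΔu⃗] =
rot f⃗*», (17) «g⃗ = ∂u⃗/∂t − [u⃗ × rot u⃗] − νΔu⃗», (18) «rot g⃗ = z⃗», the text writes «Expressing the
function g⃗ in terms of function z⃗ we can consider system of equations (19)», whose third line is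
«∂g₁/∂x₁ + ∂g₂/∂x₂ + ∂g₃/∂x₃ = 0»: `div g⃗ = 0` along every solution of (1)–(3). Typist's flag:
SUSPICIOUS (`div ∂ₜu⃗ = 0 = div Δu⃗` by (2), so the line asserts `div[u⃗ × rot u⃗] = 0`); this line is what
lets (19)–(20) determine `g⃗ = b⃗` from `f⃗` alone. Not consumed (its output is `Step_20`).
(Kaliyeva2014: (17)–(19) p.1290) [claim: Kaliyeva2014, status: disputed] -/
def Step_19 : Prop :=
  ∀ (ν : ℝ), 0 < ν → ∀ (f u : ℝ → T3 → E3) (p : ℝ → T3 → ℝ), IsForce f → RotNonzero f →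
    Torus.IsClassicalNSSolutionOn (Ici 0) ν f u p → ∀ t : ℝ, 0 ≤ t → ∀ x : T3,
      Torus.divergence (gField ν u t) x = 0

/-- **Step (20) — the reduced equation, p.1291 (LOAD-BEARING):** «∂u⃗/∂t − νΔu⃗ − [u⃗ × rot u⃗] = b⃗(x,t)
(20), where vector b⃗(x,t) = (1/4π)(b₁,b₂,b₃) has components b₁ = (∂³/∂x₃∂²x₂ + ∂³/∂³x₃)∫(1/|x−ξ|)
∫θ(ξ₃−ς₃)f₁*(ξ₁,ξ₂,ς₃,t)dς₃dξ − …» — an explicit functional of the force ALONE (through `f⃗*`), obtained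
from (16)–(19) by Fourier inversion. TYPED CHARITABLY: for every force with `rot f⃗ ≠ 0` there is SOME
field `b⃗` (depending on `f⃗` and `ν` only) such that every solution of (1)–(3) with force `f⃗`, from ANY
datum, satisfies (20) on `Ω_T` (`b⃗` jointly smooth, as the printed expression is for a smooth force).
Typist's flag: SUSPICIOUS (the gradient term `grad(u²/2 + p/ρ − Φ)` of
(15) is absent from (20); two solutions with the same force and different data must then have the same
`∂ₜu⃗ − νΔu⃗ − [u⃗ × rot u⃗]`). Regime: §IV opens with «Assume that grad(u²/2 + p/ρ − Φ) ≠ 0 (14), then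
the Navier-Stokes equations (1)-(3) can be written as (15)» — the non-potential case; under Theorem 2's
`rot f⃗ ≠ 0` no potential `Φ` as in (6) exists, so (14) is carried here as `RotNonzero` (a refuting
witness should in addition exhibit `grad(u²/2 + p) ≢ 0`, recorded for the refuter/REF).
(Kaliyeva2014: (20) p.1291 with (14)–(19) p.1290) [claim: Kaliyeva2014, status: disputed] -/
def Step_20 : Prop :=
  ∀ (ν : ℝ), 0 < ν → ∀ f : ℝ → T3 → E3, IsForce f → RotNonzero f →
    ∃ b : ℝ → T3 → E3, Torus.IsSmoothSpaceTimeOn (Ici 0) b ∧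
      ∀ (u₀ : T3 → E3) (u : ℝ → T3 → E3) (p : ℝ → T3 → ℝ),
        IsSolution ν f u₀ u p → ∀ t : ℝ, 0 ≤ t → ∀ x : T3,
          Torus.timeDerivWithin (Ici 0) u t x - ν • Torus.laplacian (u t) x - lamb (u t) x = b t x

/-- A classical solution on `[0,∞) × 𝕋³` of the reduced problem (20) + (13): `u` jointly smooth,
`u(0) = u₀`, and `∂ₜu − νΔu − [u × rot u] = b` pointwise (the paper's «problem (10)-(13)» in its §IV,
nonlinear sense: «Problem (10)-(13) is closely related with the nonlinear integral equation
u⃗ = u⃗** ∗ G + F⃗, where F⃗ = u⃗₀ ∗ G + b⃗ ∗ G», p.1291). (Kaliyeva2014: (20), (13) p.1291, p.1289) [claim: Kaliyeva2014, status: disputed] -/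
def IsReducedSolution (ν : ℝ) (b : ℝ → T3 → E3) (u₀ : T3 → E3) (u : ℝ → T3 → E3) : Prop :=
  Torus.IsSmoothSpaceTimeOn (Ici 0) u ∧ u 0 = u₀ ∧
    ∀ t : ℝ, 0 ≤ t → ∀ x : T3,
      Torus.timeDerivWithin (Ici 0) u t x - ν • Torus.laplacian (u t) x - lamb (u t) x = b t x

/-- **Step (21)–(22) — solvability of the reduced problem by successive approximations, p.1291
(LOAD-BEARING, solution grain):** «Properties of the Green's function and its derivative evaluation allow
to solve the nonlinear matrix Volterra - Fredholm integral equation by using successive approximations.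
Using Betta function B(n+½,½) = (n−1)!(√π)²/n! = π/n and well-known properties of Green's function we
have got estimations (21) [‖u^{(0)}‖² ≤ M₀(‖u₀‖²+t‖f‖²); ‖u^{(1)}‖² ≤ M₀(‖u₀‖²+t‖f‖²) +
(M₀²√t/2)(‖u₀‖²+t‖f‖²)²; ‖u^{(2)}‖² ≤ M₀(…)/1! + M₀²√t(…)²/2! + M₀³t^{3/2}(…)⁴/3!; …; ‖u^{(n)}‖² ≤
M₀(…)/1! + M₀²√t(…)²/2! + M₀³t^{3/2}(…)⁴/3! + … + M₀ⁿt^{n+1/2}(…)^{2n}/n!]. Due to this fact we have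
the unique solution of the problem (10)-(13) u⃗ = ∫₀ᵗdτ∫_Ω R[A(F⃗(ξ,τ))Γ(x−ξ,t−τ)]dΩ + F⃗(x,t) (22)».
TYPED: for every `ν > 0`, every smooth `b⃗` and every smooth periodic datum, the reduced problem
(20) + (13) has a classical solution on `[0,∞)`, and any two coincide. Typist's flag: open-strength as
typed (global smooth solvability of a 3-D quadratic parabolic system is asserted for all data); the
printed support (21) is recorded in the module docstring, its scalar face not typed in rev 1.
(Kaliyeva2014: (21)–(22) p.1291) [claim: Kaliyeva2014, status: disputed] -/
def Step_22 : Prop :=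
  ∀ (ν : ℝ), 0 < ν → ∀ b : ℝ → T3 → E3, Torus.IsSmoothSpaceTimeOn (Ici 0) b →
    ∀ u₀ : T3 → E3, Torus.IsSmooth u₀ →
      (∃ u : ℝ → T3 → E3, IsReducedSolution ν b u₀ u) ∧
        ∀ u u' : ℝ → T3 → E3, IsReducedSolution ν b u₀ u → IsReducedSolution ν b u₀ u' →
          ∀ t : ℝ, 0 ≤ t → u t = u' t

/-- **Step (23) — back to (1)–(3), p.1292 left column:** after (22): «Following the classical procedure we
get the uniqueness and stability of solution for the problem (1)-(3). Also we obtain equation for the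
pressure function u²/2 + p/ρ − div f⃗ ∗ 1/(4π|x−ξ|) − div f⃗** ∗ 1/(4π|x−ξ|) = 0 (23) where
f⃗** = b⃗ − f⃗* − 2f⃗». TYPED: whenever `b⃗` reduces the force `f⃗` in the sense of (20) (every solution of
(1)–(3) with force `f⃗` satisfies (20) with this `b⃗`), every classical solution of the reduced problem
(20) + (13) from a datum of the class is, with SOME pressure, a solution of (1)–(3). Typist's flag:
suspicious (nothing printed propagates `div u⃗ = 0` along (20); (23) fixes `p` algebraically).
(Kaliyeva2014: (22)–(23) p.1292) [claim: Kaliyeva2014, status: disputed] -/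
def Step_23 : Prop :=
  ∀ (ν : ℝ), 0 < ν → ∀ f : ℝ → T3 → E3, IsForce f → RotNonzero f → ∀ b : ℝ → T3 → E3,
    (∀ (u₀ : T3 → E3) (u : ℝ → T3 → E3) (p : ℝ → T3 → ℝ), IsSolution ν f u₀ u p →
      ∀ t : ℝ, 0 ≤ t → ∀ x : T3,
        Torus.timeDerivWithin (Ici 0) u t x - ν • Torus.laplacian (u t) x - lamb (u t) x = b t x) →
    ∀ (u₀ : T3 → E3), IsDatum u₀ → ∀ u : ℝ → T3 → E3, IsReducedSolution ν b u₀ u →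
      ∃ p : ℝ → T3 → ℝ, IsSolution ν f u₀ u p

/-! ## Kernel composition of the paper's implications -/

/-- Bookkeeping: a solution of (1)–(3) which satisfies (20) with `b⃗` is a reduced solution from its own
datum. (Kaliyeva2014: (20) p.1291) [claim: Kaliyeva2014, status: disputed] -/
theorem isReducedSolution_of_isSolution {ν : ℝ} {f : ℝ → T3 → E3} {u₀ : T3 → E3} {u : ℝ → T3 → E3}
    {p : ℝ → T3 → ℝ} {b : ℝ → T3 → E3} (h : IsSolution ν f u₀ u p)
    (hb : ∀ t : ℝ, 0 ≤ t → ∀ x : T3,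
      Torus.timeDerivWithin (Ici 0) u t x - ν • Torus.laplacian (u t) x - lamb (u t) x = b t x) :
    IsReducedSolution ν b u₀ u :=
  ⟨h.1.smooth_velocity, h.2, hb⟩


/-- **THE COMPOSITION (hypotheses in print order: (5), (6), (19), (20), (21)–(22), (23)).** Theorem 2
at the typed (smooth, classical) level follows in the kernel from the typed Steps; CONSUMED: `Step_20`
(the reducing field `b⃗[f⃗]`), `Step_22` (the unique solution of the reduced problem from `u⃗₀`),
`Step_23` (the pressure / the way back to (1)–(3)); uniqueness: two solutions of (1)–(3) satisfy (20)
with the same `b⃗` (`Step_20`), so their velocities coincide by `Step_22`. `Step_5`, `Step_6`, `Step_19`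
are taken in order and unused (they are the print's support for (15), (23) and (20)).
(Kaliyeva2014: Thm 2 p.1292 with (20)–(23) p.1291–1292) [claim: Kaliyeva2014, status: disputed] -/
theorem claim_of_steps (_h5 : Step_5) (_h6 : Step_6) (_h19 : Step_19) (h20 : Step_20) (h22 : Step_22)
    (h23 : Step_23) : ClaimedTheorem := by
  intro ν hν u₀ hu₀ f hf hrot
  obtain ⟨b, hbS, hb⟩ := h20 ν hν f hf hrot
  obtain ⟨hex, huniq⟩ := h22 ν hν b hbS u₀ hu₀.1
  refine ⟨?_, ?_⟩
  · obtain ⟨u, hu⟩ := hex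
    obtain ⟨p, hp⟩ := h23 ν hν f hf hrot b hb u₀ hu₀ u hu
    exact ⟨u, p, hp⟩
  · intro u u' p p' hu hu' t ht
    exact huniq u u' (isReducedSolution_of_isSolution hu (hb u₀ u p hu))
      (isReducedSolution_of_isSolution hu' (hb u₀ u' p' hu')) t ht

/-! ## TRUE column (in-file) -/

/-- **Step (5) HOLDS**: with `[u × rot u] := grad(½|u|²) − (u·∇)u` (the paper's (4)), the Lamb form (5)
is the momentum equation (1) rearranged. (Kaliyeva2014: (4)–(5) p.1289) [claim: Kaliyeva2014, status: disputed] -/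
theorem step_5_holds : Step_5 := by
  intro ν f u p h t ht x
  have hm := h.momentum t (mem_Ici.2 ht) x
  have hd : Torus.timeDerivWithin (Ici 0) u t x =
      ν • Torus.laplacian (u t) x - Torus.gradient (p t) x + f t x - Torus.convect (u t) (u t) x := by
    rw [← hm]; abel
  rw [hd, lamb]
  abel

end

end Literature.Claims.NS.Kaliyeva2014
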